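import Summits.NavierStokesRegularity.OSWSelfSimilar.SheetRResolventEvenClass
import HarnessLib

/-!
# SHEET-ℝ frame, EVEN ZERO-MASS class `E⁺₀` — dictionary layer 8b: `T⁺ = −A⁺_F` IN THE WEAK SENSE — the domain of Kato's closed operator
# `generatorEven` is exactly the set of `u ∈ L²_{w,even,0}(ℂ)` with energy-space coordinates and a weak image, and `T⁺u = −A⁺_F u` there

HONEST FRAMING (cell ns-blowup GROUP B / zone Z3, case Z3-SR-SPEC EVEN half; 1-D MODEL certificate frame (viscous gCLM/OSW sheet on the line);
not Euler/NS; «violates: none — MODEL»).  Nothing here asserts that a profile exists; the (S1⁺) datum `GardingDataKE` is the HYPOTHESIS.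
Twin of `SheetRGeneratorOddWeak` on the even zero-mass class (tests = ZERO-MASS even tests, profiles = `profile p`):

* `IsWeakImageE hL K d V P F` — the energy-space pair `P = (p_R, p_I)` solves the UNSHIFTED perturbed system with complex datum `F`:
  `linForm_V(u_R; v) + ∫w(Kp_R)v = ∫w(Re F)v`, `linForm_V(u_I; v) + ∫w(Kp_I)v = ∫w(Im F)v` on every zero-mass even test;
* `weak_of_mem_domainE` — `u ∈ D(T⁺)` ⇒ `u` has energy-space coordinates `P` (`toPair u = ιpairE P`) and `A⁺(u_R + iu_I) = −T⁺u` weakly;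
* `mem_domain_of_weakE` — conversely a weak image `F ∈ WcevenZ` puts `u` in `D(T⁺)` with `T⁺u = −F`; `mem_domainE_iff` (base-point free).
No definition besides the `Prop` `IsWeakImageE`; no named fact.  WHAT THIS IS NOT: not NS; no number of record moves.
-/

noncomputable section

namespace Summit.NavierStokesRegularity.OSWSelfSimilar
namespace SheetRGeneratorEvenWeak

open _root_.MeasureTheory _root_.Set _root_.Filter _root_.Real SheetRWeakProfilePV SheetRWeakToStrong SheetREnergyClass SheetRWeightedMeasure
  SheetRLinearisedTests SheetREnergySpace SheetRTestSpace SheetRLinearisedFormBounds SheetREvenTests SheetREvenEnergySpace SheetREvenForms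
  SheetREvenPairOperator SheetREvenPairUniqueness SheetREvenResolvent SheetREvenResolventIdentity SheetREvenClass SheetRResolventEvenClass
  SheetRComplexPivot SheetRResolventIdentity Literature.Analysis.OperatorTheory
open scoped Topology ENNReal

variable {L D₀ D₁ V₀ c m : ℝ} {d V : ℝ → ℝ}

/-! ### §1 The unshifted weak system with a complex datum -/

/-- **`A⁺(u_R + iu_I) = F` weakly** on zero-mass even tests. [folklore] -/
def IsWeakImageE (hL : 0 < L) (K : EspE L hL →L[ℝ] W L) (d V : ℝ → ℝ) (P : WithLp 2 (EspE L hL × EspE L hL)) (F : Wc L) : Prop :=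
  ∀ v v₁ : ℝ → ℝ, IsCompactTestE v v₁ → ∫ y, v y = 0 →
    linForm L d V (profile P.fst) (derE P.fst) v v₁ + (∫ y, (L ^ 2 + y ^ 2) * (((K P.fst : W L) : ℝ → ℝ) y * v y)) =
        ∫ y, (L ^ 2 + y ^ 2) * (((reW L F : W L) : ℝ → ℝ) y * v y) ∧
      linForm L d V (profile P.snd) (derE P.snd) v v₁ + (∫ y, (L ^ 2 + y ^ 2) * (((K P.snd : W L) : ℝ → ℝ) y * v y)) =
        ∫ y, (L ^ 2 + y ^ 2) * (((imW L F : W L) : ℝ → ℝ) y * v y)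

/-- **Potential shift with complex datum.** [folklore] -/
theorem shifted_iffE (hL : 0 < L) (K : EspE L hL →L[ℝ] W L) (h : GardingDataKE L hL d V K D₀ D₁ V₀ c m) (σ : ℂ)
    (P : WithLp 2 (EspE L hL × EspE L hL)) (F G : Wc L)
    (hre : ((reW L G : W L) : ℝ → ℝ) =ᵐ[volume] fun y =>
      σ.re * profile P.fst y - σ.im * profile P.snd y + ((reW L F : W L) : ℝ → ℝ) y)
    (him : ((imW L G : W L) : ℝ → ℝ) =ᵐ[volume] fun y =>
      σ.re * profile P.snd y + σ.im * profile P.fst y + ((imW L F : W L) : ℝ → ℝ) y)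
    (v v₁ : ℝ → ℝ) (hv : IsCompactTestE v v₁) :
    (linForm L d (fun ξ => V ξ + σ.re) (profile P.fst) (derE P.fst) v v₁
            + (∫ y, (L ^ 2 + y ^ 2) * (((K P.fst : W L) : ℝ → ℝ) y * v y))
            - σ.im * ∫ y, (L ^ 2 + y ^ 2) * (profile P.snd y * v y) = ∫ y, (L ^ 2 + y ^ 2) * (((reW L G : W L) : ℝ → ℝ) y * v y) ∧
        linForm L d (fun ξ => V ξ + σ.re) (profile P.snd) (derE P.snd) v v₁
            + (∫ y, (L ^ 2 + y ^ 2) * (((K P.snd : W L) : ℝ → ℝ) y * v y))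
            + σ.im * ∫ y, (L ^ 2 + y ^ 2) * (profile P.fst y * v y) = ∫ y, (L ^ 2 + y ^ 2) * (((imW L G : W L) : ℝ → ℝ) y * v y)) ↔
      (linForm L d V (profile P.fst) (derE P.fst) v v₁ + (∫ y, (L ^ 2 + y ^ 2) * (((K P.fst : W L) : ℝ → ℝ) y * v y)) =
          ∫ y, (L ^ 2 + y ^ 2) * (((reW L F : W L) : ℝ → ℝ) y * v y) ∧
        linForm L d V (profile P.snd) (derE P.snd) v v₁ + (∫ y, (L ^ 2 + y ^ 2) * (((K P.snd : W L) : ℝ → ℝ) y * v y)) =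
          ∫ y, (L ^ 2 + y ^ 2) * (((imW L F : W L) : ℝ → ℝ) y * v y)) := by
  have hva := hv.toIsCompactTestAny
  obtain ⟨hiR, hzR⟩ := linForm_shiftE h σ.re hva P.fst
  obtain ⟨hiI, hzI⟩ := linForm_shiftE h σ.re hva P.snd
  obtain ⟨hiF1, -⟩ := integrable_weight_mul_any hL (reW L F) hva
  obtain ⟨hiF2, -⟩ := integrable_weight_mul_any hL (imW L F) hva
  have hdat1 : ∫ y, (L ^ 2 + y ^ 2) * (((reW L G : W L) : ℝ → ℝ) y * v y) =
      σ.re * (∫ y, (L ^ 2 + y ^ 2) * (profile P.fst y * v y)) - σ.im * (∫ y, (L ^ 2 + y ^ 2) * (profile P.snd y * v y))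
        + ∫ y, (L ^ 2 + y ^ 2) * (((reW L F : W L) : ℝ → ℝ) y * v y) := by
    have e : ∫ y, (L ^ 2 + y ^ 2) * (((reW L G : W L) : ℝ → ℝ) y * v y) =
        ∫ y, (σ.re * ((L ^ 2 + y ^ 2) * (profile P.fst y * v y)) - σ.im * ((L ^ 2 + y ^ 2) * (profile P.snd y * v y))
          + (L ^ 2 + y ^ 2) * (((reW L F : W L) : ℝ → ℝ) y * v y)) := by
      refine integral_congr_ae ?_
      filter_upwards [hre] with y hy
      rw [hy]; ring
    have hI12 : Integrable (fun y => σ.re * ((L ^ 2 + y ^ 2) * (profile P.fst y * v y))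
        - σ.im * ((L ^ 2 + y ^ 2) * (profile P.snd y * v y))) := (hiR.const_mul _).sub (hiI.const_mul _)
    rw [e, integral_add hI12 hiF1, integral_sub (hiR.const_mul _) (hiI.const_mul _), integral_const_mul, integral_const_mul]
  have hdat2 : ∫ y, (L ^ 2 + y ^ 2) * (((imW L G : W L) : ℝ → ℝ) y * v y) =
      σ.re * (∫ y, (L ^ 2 + y ^ 2) * (profile P.snd y * v y)) + σ.im * (∫ y, (L ^ 2 + y ^ 2) * (profile P.fst y * v y))
        + ∫ y, (L ^ 2 + y ^ 2) * (((imW L F : W L) : ℝ → ℝ) y * v y) := by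
    have e : ∫ y, (L ^ 2 + y ^ 2) * (((imW L G : W L) : ℝ → ℝ) y * v y) =
        ∫ y, (σ.re * ((L ^ 2 + y ^ 2) * (profile P.snd y * v y)) + σ.im * ((L ^ 2 + y ^ 2) * (profile P.fst y * v y))
          + (L ^ 2 + y ^ 2) * (((imW L F : W L) : ℝ → ℝ) y * v y)) := by
      refine integral_congr_ae ?_
      filter_upwards [him] with y hy
      rw [hy]; ring
    have hI12 : Integrable (fun y => σ.re * ((L ^ 2 + y ^ 2) * (profile P.snd y * v y))
        + σ.im * ((L ^ 2 + y ^ 2) * (profile P.fst y * v y))) := (hiI.const_mul _).add (hiR.const_mul _)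
    rw [e, integral_add hI12 hiF2, integral_add (hiI.const_mul _) (hiR.const_mul _), integral_const_mul, integral_const_mul]
  rw [hzR, hzI, hdat1, hdat2]
  constructor
  · rintro ⟨e1, e2⟩
    exact ⟨by linarith, by linarith⟩
  · rintro ⟨e1, e2⟩
    exact ⟨by linarith, by linarith⟩

/-- The energy-space coordinates of `u` give its real and imaginary parts a.e. [folklore] -/
theorem re_im_ae_of_toPairE (hL : 0 < L) {u : Wc L} {P : WithLp 2 (EspE L hL × EspE L hL)} (hP : toPair L u = ιpairE hL P) :
    (((reW L u : W L) : ℝ → ℝ) =ᵐ[volume] profile P.fst) ∧ (((imW L u : W L) : ℝ → ℝ) =ᵐ[volume] profile P.snd) := by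
  obtain ⟨h1, h2⟩ := toPair_fst_snd u
  obtain ⟨hi1, hi2⟩ := ιpairE_fst_snd hL P
  rw [← h1, ← h2, hP, hi1, hi2]
  exact ⟨ιEE_ae hL P.fst, ιEE_ae hL P.snd⟩

/-- The a.e. coordinates of `F + σ·u` when `toPair u = ιpairE P`. [folklore] -/
theorem data_aeE (hL : 0 < L) (σ : ℂ) {u : Wc L} {P : WithLp 2 (EspE L hL × EspE L hL)} (hP : toPair L u = ιpairE hL P) (F : Wc L) :
    (((reW L (F + σ • u) : W L) : ℝ → ℝ) =ᵐ[volume] fun y =>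
        σ.re * profile P.fst y - σ.im * profile P.snd y + ((reW L F : W L) : ℝ → ℝ) y) ∧
      (((imW L (F + σ • u) : W L) : ℝ → ℝ) =ᵐ[volume] fun y =>
        σ.re * profile P.snd y + σ.im * profile P.fst y + ((imW L F : W L) : ℝ → ℝ) y) := by
  obtain ⟨hdre, hdim⟩ := reW_imW_add_smul_ae hL F u σ
  obtain ⟨hr, hi⟩ := re_im_ae_of_toPairE hL hP
  constructor
  · filter_upwards [hdre, hr, hi] with y hy hyr hyi
    rw [hy, hyr, hyi]; ring
  · filter_upwards [hdim, hr, hi] with y hy hyr hyi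
    rw [hy, hyr, hyi]; ring

/-! ### §2 `D(T⁺) ⊆ {A⁺ u ∈ L²_w}` and `T⁺ = −A⁺` on it -/

/-- **Elements of `D(T⁺)` are weak preimages.** [folklore] -/
theorem weak_of_mem_domainE (hL : 0 < L) (K : EspE L hL →L[ℝ] W L) (h : GardingDataKE L hL d V K D₀ D₁ V₀ c m) {σ₀ : ℂ} (hσ₀ : -m < σ₀.re)
    {u : WcevenZ hL} (hu : u ∈ (generatorEven hL K h σ₀ hσ₀).domain) :
    ∃ P : WithLp 2 (EspE L hL × EspE L hL), toPair L (u : Wc L) = ιpairE hL P ∧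
      IsWeakImageE hL K d V P (-((generatorEven hL K h σ₀ hσ₀ ⟨u, hu⟩ : WcevenZ hL) : Wc L)) := by
  obtain ⟨G₀, hG₀, hT⟩ := exists_eq_apply_of_mem_domain (J := resolventEven hL K h) (hinj := injective_resolventEven hL K h hσ₀) hu
  have hT' : generatorEven hL K h σ₀ hσ₀ ⟨u, hu⟩ = σ₀ • u - G₀ := hT
  obtain ⟨happ, -, -, hweak⟩ := resolventKE_weak hL K h hσ₀ (G₀ : Wc L)
  set P := pairOpKE hL K h σ₀ hσ₀ (toPair L (G₀ : Wc L)) with hPdef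
  have hu_eq : (u : Wc L) = resolventKE hL K h σ₀ (G₀ : Wc L) := by rw [← coe_resolventEven, hG₀]
  have hP : toPair L (u : Wc L) = ιpairE hL P := by rw [hu_eq, happ, toPair_ofPair]
  have hG₀eq : (G₀ : Wc L) = -((generatorEven hL K h σ₀ hσ₀ ⟨u, hu⟩ : WcevenZ hL) : Wc L) + σ₀ • (u : Wc L) := by
    have e : ((generatorEven hL K h σ₀ hσ₀ ⟨u, hu⟩ : WcevenZ hL) : Wc L) = σ₀ • (u : Wc L) - (G₀ : Wc L) := by
      rw [hT', Submodule.coe_sub, Submodule.coe_smul]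
    rw [e]
    abel
  obtain ⟨hre, him⟩ := data_aeE hL σ₀ hP (-((generatorEven hL K h σ₀ hσ₀ ⟨u, hu⟩ : WcevenZ hL) : Wc L))
  rw [← hG₀eq] at hre him
  exact ⟨P, hP, fun v v₁ hv h0 =>
    (shifted_iffE hL K h σ₀ P (-((generatorEven hL K h σ₀ hσ₀ ⟨u, hu⟩ : WcevenZ hL) : Wc L)) (G₀ : Wc L) hre him v v₁ hv).1
      (hweak v v₁ hv h0)⟩

/-! ### §3 `{A⁺ u ∈ L²_w} ⊆ D(T⁺)` and `T⁺u = −A⁺u` -/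

/-- **Weak preimages are in `D(T⁺)`**: if `u ∈ WcevenZ` has energy-space coordinates `P` and `A⁺(u_R + iu_I) = F` weakly with `F ∈ WcevenZ`, then
`u ∈ D(T⁺)` and `T⁺u = −F`. [folklore] -/
theorem mem_domain_of_weakE (hL : 0 < L) (K : EspE L hL →L[ℝ] W L) (h : GardingDataKE L hL d V K D₀ D₁ V₀ c m) {σ₀ : ℂ} (hσ₀ : -m < σ₀.re)
    {u F : WcevenZ hL} {P : WithLp 2 (EspE L hL × EspE L hL)} (hP : toPair L (u : Wc L) = ιpairE hL P)
    (hw : IsWeakImageE hL K d V P (F : Wc L)) :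
    ∃ hu : u ∈ (generatorEven hL K h σ₀ hσ₀).domain, generatorEven hL K h σ₀ hσ₀ ⟨u, hu⟩ = -F := by
  set G : WcevenZ hL := F + σ₀ • u with hGdef
  have hGc : (G : Wc L) = (F : Wc L) + σ₀ • (u : Wc L) := by rw [hGdef, Submodule.coe_add, Submodule.coe_smul]
  obtain ⟨hre, him⟩ := data_aeE hL σ₀ hP (F : Wc L)
  rw [← hGc] at hre him
  have hsolves : ∀ v v₁ : ℝ → ℝ, IsCompactTestE v v₁ → ∫ y, v y = 0 →
      linForm L d (fun ξ => V ξ + σ₀.re) (profile P.fst) (derE P.fst) v v₁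
            + (∫ y, (L ^ 2 + y ^ 2) * (((K P.fst : W L) : ℝ → ℝ) y * v y))
            - σ₀.im * ∫ y, (L ^ 2 + y ^ 2) * (profile P.snd y * v y) =
          ∫ y, (L ^ 2 + y ^ 2) * ((((toPair L (G : Wc L)).fst : W L) : ℝ → ℝ) y * v y) ∧
        linForm L d (fun ξ => V ξ + σ₀.re) (profile P.snd) (derE P.snd) v v₁
            + (∫ y, (L ^ 2 + y ^ 2) * (((K P.snd : W L) : ℝ → ℝ) y * v y))
            + σ₀.im * ∫ y, (L ^ 2 + y ^ 2) * (profile P.fst y * v y) =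
          ∫ y, (L ^ 2 + y ^ 2) * ((((toPair L (G : Wc L)).snd : W L) : ℝ → ℝ) y * v y) := by
    intro v v₁ hv h0
    rw [(toPair_fst_snd (G : Wc L)).1, (toPair_fst_snd (G : Wc L)).2]
    exact (shifted_iffE hL K h σ₀ P (F : Wc L) (G : Wc L) hre him v v₁ hv).2 (hw v v₁ hv h0)
  have hPeq := pairOpKE_unique hL K h σ₀ hσ₀ (toPair L (G : Wc L)) hsolves
  have hRG : resolventKE hL K h σ₀ (G : Wc L) = (u : Wc L) := by
    obtain ⟨happ, -, -, -⟩ := resolventKE_weak hL K h hσ₀ (G : Wc L)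
    rw [happ, ← hPeq, ← hP, ofPair_toPair]
  have hJ : resolventEven hL K h σ₀ G = u := Subtype.ext hRG
  have hu : u ∈ (generatorEven hL K h σ₀ hσ₀).domain := by
    rw [generatorEven_domain]
    exact ⟨G, hJ⟩
  refine ⟨hu, ?_⟩
  have hT := generatorEven_resolventEven hL K h hσ₀ hσ₀ G
  have heq : (⟨resolventEven hL K h σ₀ G, resolventEven_mem_domain hL K h hσ₀ hσ₀ G⟩ : (generatorEven hL K h σ₀ hσ₀).domain) = ⟨u, hu⟩ :=
    Subtype.ext hJ
  rw [heq, hJ] at hT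
  rw [hT, hGdef]
  abel

/-- **The domain does not depend on the base point and `T⁺ = −A⁺` there** (packaged). [folklore] -/
theorem mem_domainE_iff (hL : 0 < L) (K : EspE L hL →L[ℝ] W L) (h : GardingDataKE L hL d V K D₀ D₁ V₀ c m) {σ₀ : ℂ} (hσ₀ : -m < σ₀.re)
    (u : WcevenZ hL) :
    u ∈ (generatorEven hL K h σ₀ hσ₀).domain ↔
      ∃ (P : WithLp 2 (EspE L hL × EspE L hL)) (F : WcevenZ hL), toPair L (u : Wc L) = ιpairE hL P ∧ IsWeakImageE hL K d V P (F : Wc L) := by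
  constructor
  · intro hu
    obtain ⟨P, hP, hw⟩ := weak_of_mem_domainE hL K h hσ₀ hu
    refine ⟨P, -generatorEven hL K h σ₀ hσ₀ ⟨u, hu⟩, hP, ?_⟩
    rw [Submodule.coe_neg]
    exact hw
  · rintro ⟨P, F, hP, hw⟩
    exact (mem_domain_of_weakE hL K h hσ₀ hP hw).1

end SheetRGeneratorEvenWeak
end Summit.NavierStokesRegularity.OSWSelfSimilar

end
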